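import Literature.NumberTheory.NumberFields.CyclotomicTwoPowerPrimesOverBound
import Mathlib.FieldTheory.Galois.IsGaloisGroup
import Mathlib.NumberTheory.RamificationInertia.Galois
import Mathlib.GroupTheory.SpecificGroups.Cyclic
import HarnessLib

/-!
# A prime with ONE prime above it in a proper subfield of a CYCLIC extension of prime-power degree has ONE prime
# above it in the whole extension («inert in the first layer ⟹ inert in every layer»)

Topic `NumberTheory/NumberFields` (namespace = path).  THEOREM-ONLY file (no definition, no named fact, no instance, no `sorry`),
written by the prover seat `bsd-line-att-p3` g30 (cell `bsd-f1-sign2`; `--supports` stmt-BirchSwinnertonDyer-22298; closes nothing).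

Let `E/ℚ` be a Galois number field whose Galois group `G` is CYCLIC of prime-power order `p^n`, `M ⊆ E` a subfield with
`M ≠ ℚ`, and `ℓ` a rational prime.  The subgroups of the cyclic `p`-group `G` are totally ordered, so the decomposition group
`D = Stab_G(Q)` of a prime `Q ∣ ℓ` of `E` either contains `Gal(E/M)` or is contained in it; counting primes
(`g_E(ℓ) = [G : D]`, transitivity of `Gal(E/M)` on the primes of `E` above a prime of `M`) gives:

* §1 `eq_top_of_forall_exists_mul_of_isCyclic` — the group-theoretic heart (Frattini argument): in a cyclic group of order
  `p^n`, if `H ≠ ⊤` and every element is a product `h · d` (`h ∈ H`, `d ∈ D`), then `D = ⊤` (otherwise `|H|, |D| ∣ p^{n-1}`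
  and every element would be killed by `p^{n-1}`, contradicting `exp G = p^n`).
* §2 **`ncard_primesOver_eq_one_of_isCyclic`** — `E/ℚ` Galois with cyclic group of order `p^n`, `ℚ ⊊ M ⊆ E`, `ℓ` prime with
  exactly ONE prime of `𝓞 M` above it ⟹ exactly ONE prime of `𝓞 E` above it; `ncard_primesOver_eq_one_of_algebra_of_eq_one` —
  the (trivial) converse: one prime upstairs ⟹ one prime in every subfield; **`ncard_primesOver_eq_one_iff_of_isCyclic`**.
* §3 `ncard_primesOver_dvd_finrank` — for `E/ℚ` Galois the number `g_E(ℓ)` of primes above `ℓ` divides `[E : ℚ]`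
  (fundamental identity `g·e·f = [E:ℚ]`); `ncard_primesOver_eq_two_pow` / **`odd_ncard_primesOver_iff_eq_one`** — if
  `[E : ℚ] = 2^n` then `g_E(ℓ)` is a power of `2`, so it is odd iff it equals `1`.

These are the inputs of the parity count of ramified primes in the cyclotomic `ℤ₂`-tower
(`IwasawaTheory/CyclotomicTwoTowerOddPrimeDecomposition.lean`): a prime is «inert» in `ℚ_n` (`n ≥ 1`) iff it is inert in
`ℚ_1 = ℚ(√2)`.

HONEST SCOPE: textbook Hilbert theory (decomposition groups in a cyclic extension); nothing here is specific to any summit;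
BSD is not proved by any of this.

## References
* D. A. Marcus, *Number Fields*, 2nd ed. (2018), Ch. 4 (decomposition and inertia groups; Thm. 28 and the exercises on
  cyclic extensions). [Marcus2018]
* J. Neukirch, *Algebraic Number Theory* (1999), Ch. I §9 (9.1)–(9.4) (transitivity, `g = [G : G_𝔓]`). [NeukirchANT1999]
* L. C. Washington, *Introduction to Cyclotomic Fields*, 2nd ed. (1997), §13.1 (primes in `ℚ_∞/ℚ` are finitely decomposed,
  then inert). [Washington1997]
-/

set_option autoImplicit false

noncomputable section

open NumberField IsDedekindDomain Ideal Module
open scoped Pointwise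

namespace Literature.NumberTheory.NumberFields

/-! ## §1 The Frattini argument in a cyclic `p`-group -/

/-- **In a cyclic group of order `p^n`: if `H ≠ ⊤` and `G = H · D` (every element is `h · d` with `h ∈ H`, `d ∈ D`), then
`D = ⊤`.**  Otherwise `|H|` and `|D|` divide `p^{n-1}`, so (the group being commutative) every `x = h d` satisfies
`x^{p^{n-1}} = 1`, contradicting `exp G = |G| = p^n`. [cite: Marcus2018, Ch. 4 (cyclic decomposition groups)] -/
theorem eq_top_of_forall_exists_mul_of_isCyclic {G : Type*} [Group G] [Finite G] [IsCyclic G] {p n : ℕ}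
    (hp : p.Prime) (hG : Nat.card G = p ^ n) (H D : Subgroup G) (hH : H ≠ ⊤)
    (hHD : ∀ x : G, ∃ h ∈ H, ∃ d ∈ D, x = h * d) : D = ⊤ := by
  by_contra hD
  -- `n = m + 1`
  obtain ⟨m, rfl⟩ : ∃ m, n = m + 1 := by
    refine ⟨n - 1, (Nat.sub_one_add_one_eq_of_pos (Nat.pos_of_ne_zero ?_)).symm⟩
    rintro rfl
    rw [pow_zero] at hG
    haveI : Subsingleton G := (Nat.card_eq_one_iff_unique.mp hG).1
    exact hH (Subsingleton.elim _ _)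
  -- a proper subgroup has order dividing `p^m`
  have hproper : ∀ S : Subgroup G, S ≠ ⊤ → Nat.card S ∣ p ^ m := by
    intro S hS
    obtain ⟨a, ha, hSa⟩ := (Nat.dvd_prime_pow hp).mp (hG ▸ Subgroup.card_subgroup_dvd_card S)
    have ham : a ≠ m + 1 := by
      rintro rfl
      exact hS (Subgroup.eq_top_of_card_eq S (by rw [hSa, hG]))
    rw [hSa]
    exact pow_dvd_pow p (by omega)
  have hHm := hproper H hH
  have hDm := hproper D hD
  -- commutativity from cyclicity
  obtain ⟨g, hg⟩ := IsCyclic.exists_generator (α := G)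
  have hcomm : ∀ x y : G, Commute x y := by
    intro x y
    obtain ⟨i, rfl⟩ := Subgroup.mem_zpowers_iff.mp (hg x)
    obtain ⟨j, rfl⟩ := Subgroup.mem_zpowers_iff.mp (hg y)
    exact Commute.zpow_zpow (Commute.refl g) i j
  have key : ∀ x : G, x ^ (p ^ m) = 1 := by
    intro x
    obtain ⟨h, hh, d, hd, rfl⟩ := hHD x
    have h1 : h ^ (p ^ m) = 1 :=
      orderOf_dvd_iff_pow_eq_one.mp ((Subgroup.orderOf_dvd_natCard H hh).trans hHm)
    have h2 : d ^ (p ^ m) = 1 :=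
      orderOf_dvd_iff_pow_eq_one.mp ((Subgroup.orderOf_dvd_natCard D hd).trans hDm)
    rw [(hcomm h d).mul_pow, h1, h2, one_mul]
  have hexp : Monoid.exponent G ∣ p ^ m := Monoid.exponent_dvd_of_forall_pow_eq_one key
  rw [IsCyclic.exponent_eq_card, hG] at hexp
  have hle := Nat.le_of_dvd (pow_pos hp.pos m) hexp
  exact absurd hle (not_le.mpr (Nat.pow_lt_pow_right hp.one_lt (lt_add_one m)))

/-! ## §2 One prime below ⟹ one prime above, in a cyclic extension of prime-power degree -/

section NumberFields

variable (E : Type*) [Field E] [NumberField E] (M : Type*) [Field M] [NumberField M] [Algebra M E]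

/-- **One prime above `ℓ` in `E` ⟹ one prime above `ℓ` in every subfield `M ⊆ E`** (every prime of `M` above `ℓ` lies under
a prime of `E` above `ℓ`; tree `ncard_primesOver_le_of_algebra`). [cite: NeukirchANT1999, Ch. I §9 (9.1)] -/
theorem ncard_primesOver_eq_one_of_algebra_of_eq_one {ℓ : ℕ} (hℓ : ℓ.Prime)
    (hone : ((Ideal.span {(ℓ : ℤ)}).primesOver (𝓞 E)).ncard = 1) :
    ((Ideal.span {(ℓ : ℤ)}).primesOver (𝓞 M)).ncard = 1 := by
  haveI : Fact ℓ.Prime := ⟨hℓ⟩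
  haveI : (Ideal.span {(ℓ : ℤ)}).IsMaximal := Int.ideal_span_isMaximal_of_prime ℓ
  refine le_antisymm (hone ▸ ncard_primesOver_le_of_algebra M E hℓ) ?_
  obtain ⟨⟨Q, hQ⟩⟩ := (Ideal.span {(ℓ : ℤ)}).nonempty_primesOver (S := 𝓞 M)
  exact (Set.ncard_pos (IsDedekindDomain.primesOver_finite _ _)).mpr ⟨Q, hQ⟩

variable [IsGalois ℚ E] [IsScalarTower ℚ M E]

/-- **Cyclic extensions of prime-power degree: a prime with ONE prime above it in a subfield `M ≠ ℚ` has ONE prime above it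
in `E`.**  `E/ℚ` Galois with `Gal(E/ℚ)` cyclic of order `p^n`, `M ⊆ E` with `[M : ℚ] > 1`, `ℓ` prime with a unique prime
`q` of `𝓞 M` above it.  For a prime `Q ∣ ℓ` of `E` and `σ ∈ G`, `σQ ∩ M = q = Q ∩ M`, so `σQ = τQ` for some `τ ∈ Gal(E/M)`
(transitivity on the primes above `q`): `G = Gal(E/M) · Stab(Q)`, whence `Stab(Q) = G` (§1) and `Q` is the only prime above
`ℓ` (`{primes above ℓ} = G · Q`). [cite: Marcus2018, Ch. 4 Thm. 28 (decomposition groups; cyclic case)]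
[cite: NeukirchANT1999, Ch. I §9 (9.1)–(9.4)] -/
theorem ncard_primesOver_eq_one_of_isCyclic [IsCyclic (E ≃ₐ[ℚ] E)] {p n : ℕ} (hp : p.Prime)
    (hcard : Module.finrank ℚ E = p ^ n) (hM : 1 < Module.finrank ℚ M) {ℓ : ℕ} (hℓ : ℓ.Prime)
    (hone : ((Ideal.span {(ℓ : ℤ)}).primesOver (𝓞 M)).ncard = 1) :
    ((Ideal.span {(ℓ : ℤ)}).primesOver (𝓞 E)).ncard = 1 := by
  classical
  haveI : Fact ℓ.Prime := ⟨hℓ⟩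
  set P : Ideal ℤ := Ideal.span {(ℓ : ℤ)} with hPdef
  haveI hPmax : P.IsMaximal := Int.ideal_span_isMaximal_of_prime ℓ
  -- the Galois group and its order
  set G := (E ≃ₐ[ℚ] E) with hGdef
  have hG : Nat.card G = p ^ n := by rw [hGdef, IsGalois.card_aut_eq_finrank, hcard]
  -- a prime `Q` of `E` above `ℓ`, and the prime `q = Q ∩ 𝓞 M` of `M` below it
  obtain ⟨⟨Q, hQprime, hQover⟩⟩ := P.nonempty_primesOver (S := 𝓞 E)
  haveI := hQprime
  haveI := hQover
  set q : Ideal (𝓞 M) := Q.under (𝓞 M) with hqdef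
  haveI hqQ : Q.LiesOver q := ⟨rfl⟩
  haveI : q.IsPrime := Ideal.IsPrime.under (𝓞 M) Q
  have hqP : q.LiesOver P := Ideal.LiesOver.tower_bot Q q P
  -- uniqueness of the prime of `M` above `ℓ`
  obtain ⟨q₀, hq₀⟩ := Set.ncard_eq_one.mp hone
  have huniq : ∀ q' : Ideal (𝓞 M), q'.IsPrime → q'.LiesOver P → q' = q := by
    intro q' h1 h2
    have ha : q' ∈ P.primesOver (𝓞 M) := ⟨h1, h2⟩
    have hb : q ∈ P.primesOver (𝓞 M) := ⟨inferInstance, hqP⟩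
    rw [hq₀, Set.mem_singleton_iff] at ha hb
    rw [ha, hb]
  -- `H = Gal(E/M) ≤ G` as the fixing subgroup of `M`
  set H : Subgroup G := fixingSubgroup G (Set.range (algebraMap M E)) with hHdef
  haveI hHME : IsGaloisGroup H M E := IsGaloisGroup.of_isScalarTower G ℚ E M
  haveI hHME' : IsGaloisGroup H (𝓞 M) (𝓞 E) := IsGaloisGroup.of_isFractionRing H (𝓞 M) (𝓞 E) M E
  have hHcard : Nat.card H = Module.finrank M E := IsGaloisGroup.card_eq_finrank H M E
  have hHne : H ≠ ⊤ := by
    intro hH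
    have h1 : Nat.card H = Nat.card G := by rw [hH, Subgroup.card_top]
    have h2 : Module.finrank ℚ M * Module.finrank M E = Module.finrank ℚ E := Module.finrank_mul_finrank ℚ M E
    rw [hHcard, hGdef, IsGalois.card_aut_eq_finrank] at h1
    have hpos : 0 < Module.finrank M E := Module.finrank_pos
    nlinarith
  -- `D = Stab_G(Q)` and the Frattini decomposition `G = H · D`
  set D : Subgroup G := MulAction.stabilizer G Q with hDdef
  have hHD : ∀ σ : G, ∃ τ ∈ H, ∃ δ ∈ D, σ = τ * δ := by
    intro σ
    haveI : (σ • Q).IsPrime := hQprime.smul σ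
    haveI : (σ • Q).LiesOver P := hQover.smul σ
    -- `σ Q ∩ M = q`
    have hq' : (σ • Q).under (𝓞 M) = q :=
      huniq _ (Ideal.IsPrime.under (𝓞 M) (σ • Q)) (Ideal.LiesOver.tower_bot (σ • Q) ((σ • Q).under (𝓞 M)) P)
    haveI : (σ • Q).LiesOver q := ⟨hq'.symm⟩
    obtain ⟨τ, hτ⟩ := Ideal.exists_smul_eq_of_isGaloisGroup q Q (σ • Q) H
    have hτ' : (τ : G) • Q = σ • Q := by
      rw [← hτ]
      rfl
    refine ⟨τ, τ.2, (τ : G)⁻¹ * σ, ?_, by group⟩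
    rw [hDdef, MulAction.mem_stabilizer_iff, mul_smul, ← hτ', ← mul_smul, inv_mul_cancel, one_smul]
  have hDtop : D = ⊤ := eq_top_of_forall_exists_mul_of_isCyclic hp hG H D hHne hHD
  -- the primes above `ℓ` form the `G`-orbit of `Q`, of size `[G : D] = 1`
  have horbit := Algebra.IsInvariant.orbit_eq_primesOver ℤ (𝓞 E) G P Q
  rw [← horbit, ← MulAction.index_stabilizer, ← hDdef, hDtop, Subgroup.index_top]

/-- **`g_E(ℓ) = 1 ⟺ g_M(ℓ) = 1`** for `E/ℚ` cyclic of prime-power degree and `ℚ ⊊ M ⊆ E`.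
[cite: Marcus2018, Ch. 4 Thm. 28 (decomposition groups; cyclic case)] -/
theorem ncard_primesOver_eq_one_iff_of_isCyclic [IsCyclic (E ≃ₐ[ℚ] E)] {p n : ℕ} (hp : p.Prime)
    (hcard : Module.finrank ℚ E = p ^ n) (hM : 1 < Module.finrank ℚ M) {ℓ : ℕ} (hℓ : ℓ.Prime) :
    ((Ideal.span {(ℓ : ℤ)}).primesOver (𝓞 E)).ncard = 1 ↔ ((Ideal.span {(ℓ : ℤ)}).primesOver (𝓞 M)).ncard = 1 :=
  ⟨ncard_primesOver_eq_one_of_algebra_of_eq_one E M hℓ, ncard_primesOver_eq_one_of_isCyclic E M hp hcard hM hℓ⟩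

end NumberFields

/-! ## §3 The number of primes above `ℓ` divides the degree; for `2`-power degree it is odd iff it is `1` -/

section Count

variable (E : Type*) [Field E] [NumberField E] [IsGalois ℚ E]

/-- **`g_E(ℓ) ∣ [E : ℚ]`** for a Galois number field `E` (fundamental identity `g · e · f = [E : ℚ]`).
[cite: NeukirchANT1999, Ch. I §9 (9.2)] -/
theorem ncard_primesOver_dvd_finrank {ℓ : ℕ} (hℓ : ℓ.Prime) :
    ((Ideal.span {(ℓ : ℤ)}).primesOver (𝓞 E)).ncard ∣ Module.finrank ℚ E := by
  haveI : Fact ℓ.Prime := ⟨hℓ⟩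
  haveI : (Ideal.span {(ℓ : ℤ)}).IsMaximal := Int.ideal_span_isMaximal_of_prime ℓ
  have h := Ideal.ncard_primesOver_mul_ramificationIdxIn_mul_inertiaDegIn (Ideal.span {(ℓ : ℤ)}) (𝓞 E) (E ≃ₐ[ℚ] E)
  rw [IsGalois.card_aut_eq_finrank] at h
  exact ⟨_, h.symm⟩

/-- **If `[E : ℚ] = 2^n` then `g_E(ℓ) = 2^a` for some `a ≤ n`.** [cite: NeukirchANT1999, Ch. I §9 (9.2)] -/
theorem ncard_primesOver_eq_two_pow {n : ℕ} (hE : Module.finrank ℚ E = 2 ^ n) {ℓ : ℕ} (hℓ : ℓ.Prime) :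
    ∃ a ≤ n, ((Ideal.span {(ℓ : ℤ)}).primesOver (𝓞 E)).ncard = 2 ^ a := by
  obtain ⟨a, ha, h⟩ := (Nat.dvd_prime_pow Nat.prime_two).mp (hE ▸ ncard_primesOver_dvd_finrank E hℓ)
  exact ⟨a, ha, h⟩

/-- **If `[E : ℚ] = 2^n` then `g_E(ℓ)` is odd iff `g_E(ℓ) = 1`.** [cite: NeukirchANT1999, Ch. I §9 (9.2)] -/
theorem odd_ncard_primesOver_iff_eq_one {n : ℕ} (hE : Module.finrank ℚ E = 2 ^ n) {ℓ : ℕ} (hℓ : ℓ.Prime) :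
    Odd ((Ideal.span {(ℓ : ℤ)}).primesOver (𝓞 E)).ncard ↔ ((Ideal.span {(ℓ : ℤ)}).primesOver (𝓞 E)).ncard = 1 := by
  obtain ⟨a, -, h⟩ := ncard_primesOver_eq_two_pow E hE hℓ
  rw [h]
  constructor
  · intro hodd
    cases a with
    | zero => rfl
    | succ a => exact absurd (Nat.even_pow.mpr ⟨even_two, Nat.succ_ne_zero a⟩) (Nat.not_even_iff_odd.mpr hodd)
  · intro h1
    rw [h1]; exact odd_one

end Count

end Literature.NumberTheory.NumberFields

end
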